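import Summits.Ventures.QEC.CircuitDistance.PortNormalise
import Summits.Ventures.QEC.CircuitDistance.SchedNormal
import HarnessLib

/-!
# Q4 lane, ₛ-spine (5): NORMALISATION, monotonicity in `Nc` and the GAP lemma, for any CNOT order
# (venture QEC, experiment cell CDX; drafted by qec-cdx-idea-2 g2, typed by qec-cdx-type-2, statement audit qec-cdx-crit-1, director-qec R158; the `PortNormalise.lean` layer of record re-pointed to
# `allEventsₛ σ Nc` under `hσ : σ.CycleFacts S`; nothing here asserts a value of `d_circ`)

* column bookkeeping at `Gen` level over an arbitrary event list: `Gen.sameCols_erase_zero` / `_erase_pair` / `_trade`,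
  `Gen.transfer_sameCols` (proofs verbatim; `add_self_add`, `eq_initZ_of_loc_eq` are the tree's);
* **`exists_normalₛ`** (hσ): every undetectable logical fault set of the `Nc`-circuit of `σ` is matched by a NORMAL one with no
  more faulty operations;
* **`hasAtₛ_mono_cycles`** (hσ): `Nc ≤ Nc' → HasAtₛ σ S Nc w → HasAtₛ σ S Nc' w` (supersedes the causality-only `hasAtₛ_of_one`);
* **`undetectable_splitₛ`** (hσ; GAP LEMMA): splitting a normal undetectable set at a fault-free cycle gives two undetectable sets.
Generic in `σ` and `S`.
-/

namespace Summit.Ventures.QEC.CircuitDistance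

open Literature.InformationTheory.QuantumCodes

variable {ℓ m : ℕ} [NeZero ℓ] [NeZero m]

/-! ### Elementary column bookkeeping, for an arbitrary event list -/

/-- Removing a zero column keeps all columns of the set. -/
theorem Gen.sameCols_erase_zero (S : SMCode ℓ m) (Nc : ℕ) (es : List Ev) (F : Finset (Fault ℓ m)) {f : Fault ℓ m} (hf : f ∈ F)
    (h0 : Gen.SameCols S Nc es {f} ∅) : Gen.SameCols S Nc es F (F.erase f) := by
  obtain ⟨hX, hZ, hdX, hdZ⟩ := h0
  have hX' : ∀ t i, Gen.detX S Nc es {f} t i = false := fun t i => by rw [← hX t i, Gen.detX_eq_bsum]; exact bsum_empty _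
  have hZ' : ∀ t j, Gen.detZ S Nc es {f} t j = false := fun t j => by rw [← hZ t j, Gen.detZ_eq_bsum]; exact bsum_empty _
  have hdX' : Gen.dataX S es {f} = 0 := by rw [← hdX, Gen.dataX_eq_sum, Finset.sum_empty]
  have hdZ' : Gen.dataZ S es {f} = 0 := by rw [← hdZ, Gen.dataZ_eq_sum, Finset.sum_empty]
  have hF : F = insert f (F.erase f) := (Finset.insert_erase hf).symm
  refine ⟨fun t i => ?_, fun t j => ?_, ?_, ?_⟩
  · conv_rhs => rw [hF]
    rw [Gen.detX_eq_bsum, Gen.detX_eq_bsum S Nc es (insert f _), bsum_insert (Finset.notMem_erase f F), hX', Bool.false_xor]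
  · conv_rhs => rw [hF]
    rw [Gen.detZ_eq_bsum, Gen.detZ_eq_bsum S Nc es (insert f _), bsum_insert (Finset.notMem_erase f F), hZ', Bool.false_xor]
  · conv_rhs => rw [hF]
    rw [Gen.dataX_eq_sum, Gen.dataX_eq_sum S es (insert f _), Finset.sum_insert (Finset.notMem_erase f F), hdX', zero_add]
  · conv_rhs => rw [hF]
    rw [Gen.dataZ_eq_sum, Gen.dataZ_eq_sum S es (insert f _), Finset.sum_insert (Finset.notMem_erase f F), hdZ', zero_add]

/-- Removing two equal columns keeps all columns of the set. -/
theorem Gen.sameCols_erase_pair (S : SMCode ℓ m) (Nc : ℕ) (es : List Ev) (F : Finset (Fault ℓ m)) {f g : Fault ℓ m} (hf : f ∈ F) (hg : g ∈ F)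
    (hne : f ≠ g) (hfg : Gen.SameCols S Nc es {f} {g}) : Gen.SameCols S Nc es F ((F.erase f).erase g) := by
  obtain ⟨hX, hZ, hdX, hdZ⟩ := hfg
  have hgR : g ∈ F.erase f := Finset.mem_erase.2 ⟨hne.symm, hg⟩
  have hF : F = insert f (insert g ((F.erase f).erase g)) := by rw [Finset.insert_erase hgR, Finset.insert_erase hf]
  have hf' : f ∉ insert g ((F.erase f).erase g) := by
    rw [Finset.mem_insert, not_or]; exact ⟨hne, fun h => (Finset.mem_erase.1 (Finset.mem_of_mem_erase h)).1 rfl⟩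
  have hg' : g ∉ (F.erase f).erase g := Finset.notMem_erase g _
  refine ⟨fun t i => ?_, fun t j => ?_, ?_, ?_⟩
  · conv_rhs => rw [hF]
    rw [Gen.detX_eq_bsum, Gen.detX_eq_bsum S Nc es (insert f _), bsum_insert hf', bsum_insert hg']
    rw [show Gen.detX S Nc es {f} t i = Gen.detX S Nc es {g} t i by rw [← hX t i]]
    cases Gen.detX S Nc es {g} t i <;> simp
  · conv_rhs => rw [hF]
    rw [Gen.detZ_eq_bsum, Gen.detZ_eq_bsum S Nc es (insert f _), bsum_insert hf', bsum_insert hg']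
    rw [show Gen.detZ S Nc es {f} t j = Gen.detZ S Nc es {g} t j by rw [← hZ t j]]
    cases Gen.detZ S Nc es {g} t j <;> simp
  · conv_rhs => rw [hF]
    rw [Gen.dataX_eq_sum, Gen.dataX_eq_sum S es (insert f _), Finset.sum_insert hf', Finset.sum_insert hg', ← hdX, add_self_add]
  · conv_rhs => rw [hF]
    rw [Gen.dataZ_eq_sum, Gen.dataZ_eq_sum S es (insert f _), Finset.sum_insert hf', Finset.sum_insert hg', ← hdZ, add_self_add]

/-- Trading a fault for an absent fault with the same column keeps all columns of the set. -/
theorem Gen.sameCols_trade (S : SMCode ℓ m) (Nc : ℕ) (es : List Ev) (F : Finset (Fault ℓ m)) {f g : Fault ℓ m} (hf : f ∈ F) (hg : g ∉ F)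
    (hfg : Gen.SameCols S Nc es {f} {g}) : Gen.SameCols S Nc es F (insert g (F.erase f)) := by
  obtain ⟨hX, hZ, hdX, hdZ⟩ := hfg
  have hF : F = insert f (F.erase f) := (Finset.insert_erase hf).symm
  have hg' : g ∉ F.erase f := fun h => hg (Finset.mem_of_mem_erase h)
  refine ⟨fun t i => ?_, fun t j => ?_, ?_, ?_⟩
  · conv_rhs => rw [hF]
    rw [Gen.detX_eq_bsum, Gen.detX_eq_bsum S Nc es (insert f _), bsum_insert hg', bsum_insert (Finset.notMem_erase f F), hX]
  · conv_rhs => rw [hF]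
    rw [Gen.detZ_eq_bsum, Gen.detZ_eq_bsum S Nc es (insert f _), bsum_insert hg', bsum_insert (Finset.notMem_erase f F), hZ]
  · conv_rhs => rw [hF]
    rw [Gen.dataX_eq_sum, Gen.dataX_eq_sum S es (insert f _), Finset.sum_insert hg', Finset.sum_insert (Finset.notMem_erase f F), hdX]
  · conv_rhs => rw [hF]
    rw [Gen.dataZ_eq_sum, Gen.dataZ_eq_sum S es (insert f _), Finset.sum_insert hg', Finset.sum_insert (Finset.notMem_erase f F), hdZ]

/-- `SameCols` transports undetectability and logical error (the event clause is supplied separately). -/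
theorem Gen.transfer_sameCols (S : SMCode ℓ m) (Nc : ℕ) (es : List Ev) {F F' : Finset (Fault ℓ m)}
    (h : Gen.SameCols S Nc es F F') (hev : ∀ f ∈ F', f.ev ∈ es) (hU : Gen.Undetectable S Nc es F)
    (hL : Gen.LogicalError S es F) : Gen.Undetectable S Nc es F' ∧ Gen.LogicalError S es F' := by
  obtain ⟨hX, hZ, hdX, hdZ⟩ := h
  refine ⟨⟨hev, fun t i => ⟨?_, ?_⟩⟩, ?_⟩
  · rw [hX]; exact (hU.2 t i).1
  · rw [hZ]; exact (hU.2 t i).2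
  · unfold Gen.LogicalError at hL ⊢; rw [hdX, hdZ]; exact hL


/-! ## Normalisation, monotonicity, gap -/

/-- **NORMALISATION.** Every undetectable logical fault set of the `Nc`-circuit is matched by a NORMAL one with no more
faulty operations. -/
theorem exists_normalₛ {σ : SMSchedule} {S : SMCode ℓ m} (hσ : σ.CycleFacts S) (Nc : ℕ)
    (F : Finset (Fault ℓ m)) (hU : Undetectableₛ σ S Nc F) (hL : LogicalErrorₛ σ S Nc F) :
    ∃ F' : Finset (Fault ℓ m), Normal Nc F' ∧ Undetectableₛ σ S Nc F' ∧ LogicalErrorₛ σ S Nc F' ∧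
      faultCount F' ≤ faultCount F := by
  unfold Undetectableₛ at hU ⊢; unfold LogicalErrorₛ at hL ⊢
  classical
  induction hn : (F.filter fun f => f.isInitZ = true).card using Nat.strong_induction_on generalizing F with
  | _ n ih =>
    by_cases h0 : (F.filter fun f => f.isInitZ = true) = ∅
    · refine ⟨F, fun f hf => ?_, hU, hL, le_rfl⟩
      have hev := hU.1 f hf
      rw [hσ.mem_allEventsₛ_iff, Fault.ev_cyc] at hev
      refine ⟨hev.1, hev.2, ?_⟩
      by_contra hI
      have : f ∈ F.filter fun f => f.isInitZ = true := Finset.mem_filter.2 ⟨hf, by simpa using hI⟩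
      rw [h0] at this; simp at this
    · obtain ⟨f, hfF⟩ := Finset.nonempty_iff_ne_empty.2 h0
      obtain ⟨hf, hfI⟩ := Finset.mem_filter.1 hfF
      -- `f` is an `InitZ` fault in the circuit
      obtain ⟨c, j, rfl⟩ : ∃ c j, f = Fault.initZ c j := by
        cases f <;> simp [Fault.isInitZ] at hfI; exact ⟨_, _, rfl⟩
      have hev := hU.1 _ hf
      rw [hσ.mem_allEventsₛ_iff, Fault.ev_cyc] at hev
      change 1 ≤ c ∧ c ≤ Nc at hev
      -- count of InitZ faults drops in all three replacements
      have hcount_erase : ((F.erase (Fault.initZ c j)).filter fun f => f.isInitZ = true).card < n := by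
        rw [Finset.filter_erase, Finset.card_erase_of_mem hfF]; have := Finset.card_pos.2 ⟨_, hfF⟩; omega
      by_cases hlast : c = Nc
      · -- zero column: drop it
        subst hlast
        have hsc := Gen.sameCols_erase_zero S c (allEventsₛ σ c) F hf (initZ_last_sameColsₛ hσ c j hev.1)
        obtain ⟨hU₁, hL₁⟩ := Gen.transfer_sameCols S c (allEventsₛ σ c) hsc (fun g hg => hU.1 g (Finset.mem_of_mem_erase hg)) hU hL
        obtain ⟨F', hN', hU', hL', hc'⟩ := ih _ hcount_erase (F.erase (Fault.initZ c j)) hU₁ hL₁ rfl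
        exact ⟨F', hN', hU', hL', hc'.trans (Finset.card_le_card (Finset.image_subset_image (Finset.erase_subset _ _)))⟩
      · have hc1 : c + 1 ≤ Nc := by omega
        have hsc := initZ_measZ_sameColsₛ hσ Nc c j hev.1 hc1
        set g : Fault ℓ m := Fault.measZ (c + 1) j with hg
        have hgev : g.ev ∈ allEventsₛ σ Nc := by rw [hσ.mem_allEventsₛ_iff, Fault.ev_cyc]; change 1 ≤ c + 1 ∧ c + 1 ≤ Nc; omega
        have hne : Fault.initZ c j ≠ g := by rw [hg]; simp
        by_cases hgF : g ∈ F
        · -- both present: they cancel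
          have hsc2 := Gen.sameCols_erase_pair S Nc (allEventsₛ σ Nc) F hf hgF hne hsc
          obtain ⟨hU₁, hL₁⟩ := Gen.transfer_sameCols S Nc (allEventsₛ σ Nc) hsc2
            (fun x hx => hU.1 x (Finset.mem_of_mem_erase (Finset.mem_of_mem_erase hx))) hU hL
          have hlt : (((F.erase (Fault.initZ c j)).erase g).filter fun f => f.isInitZ = true).card < n := by
            refine lt_of_le_of_lt (Finset.card_le_card (Finset.filter_subset_filter _ (Finset.erase_subset _ _))) hcount_erase
          obtain ⟨F', hN', hU', hL', hc'⟩ := ih _ hlt _ hU₁ hL₁ rfl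
          refine ⟨F', hN', hU', hL', hc'.trans (Finset.card_le_card (Finset.image_subset_image ?_))⟩
          exact (Finset.erase_subset _ _).trans (Finset.erase_subset _ _)
        · -- trade InitZ@c for MeasZ@(c+1)
          have hsc2 := Gen.sameCols_trade S Nc (allEventsₛ σ Nc) F hf hgF hsc
          obtain ⟨hU₁, hL₁⟩ := Gen.transfer_sameCols S Nc (allEventsₛ σ Nc) hsc2 (fun x hx => by
            rcases Finset.mem_insert.1 hx with rfl | hx
            · exact hgev
            · exact hU.1 x (Finset.mem_of_mem_erase hx)) hU hL
          have hlt : ((insert g (F.erase (Fault.initZ c j))).filter fun f => f.isInitZ = true).card < n := by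
            rw [Finset.filter_insert, if_neg (by rw [hg]; simp [Fault.isInitZ])]; exact hcount_erase
          obtain ⟨F', hN', hU', hL', hc'⟩ := ih _ hlt _ hU₁ hL₁ rfl
          refine ⟨F', hN', hU', hL', hc'.trans ?_⟩
          -- faultCount (insert g (F.erase f)) ≤ faultCount F
          unfold faultCount
          rw [Finset.image_insert]
          have hsub : (F.erase (Fault.initZ c j)).image Fault.loc ⊆ (F.image Fault.loc).erase (Fault.initZ c j).loc := by
            intro x hx
            obtain ⟨y, hy, rfl⟩ := Finset.mem_image.1 hx
            refine Finset.mem_erase.2 ⟨fun h => ?_, Finset.mem_image_of_mem _ (Finset.mem_of_mem_erase hy)⟩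
            exact (Finset.mem_erase.1 hy).1 (eq_initZ_of_loc_eq h)
          calc (insert g.loc ((F.erase (Fault.initZ c j)).image Fault.loc)).card
              ≤ ((F.erase (Fault.initZ c j)).image Fault.loc).card + 1 := Finset.card_insert_le _ _
            _ ≤ ((F.image Fault.loc).erase (Fault.initZ c j).loc).card + 1 := by
                have := Finset.card_le_card hsub; omega
            _ = (F.image Fault.loc).card := by
                rw [Finset.card_erase_of_mem (Finset.mem_image_of_mem _ hf)]
                have := Finset.card_pos.2 ⟨_, Finset.mem_image_of_mem Fault.loc hf⟩; omega

/-- **Monotonicity in `Nc`.** A longer circuit contains every undetectable logical fault set of a shorter one (after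
normalisation). -/
theorem hasAtₛ_mono_cycles {σ : SMSchedule} {S : SMCode ℓ m} (hσ : σ.CycleFacts S) {Nc Nc' : ℕ}
    (h : Nc ≤ Nc') (w : ℕ) : HasLogicalFaultOfWeightAtMostAtₛ σ S Nc w → HasLogicalFaultOfWeightAtMostAtₛ σ S Nc' w := by
  rintro ⟨F, hU, hL, hw⟩
  obtain ⟨F', hN, hU', hL', hc⟩ := exists_normalₛ hσ Nc F hU hL
  obtain ⟨hU'', hL''⟩ := transfer_normalₛ hσ F' hN (fun f hf => (hN f hf).2.1.trans h) hU' hL'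
  exact ⟨F', hU'', hL'', hc.trans hw⟩

/-! ## Gap, shift, truncate -/

/-- GAP LEMMA: splitting a normal undetectable set at a fault-free cycle `s` gives two undetectable sets. -/
theorem undetectable_splitₛ {σ : SMSchedule} {S : SMCode ℓ m} (hσ : σ.CycleFacts S) (Nc : ℕ) (F : Finset (Fault ℓ m))
    (hN : Normal Nc F) (hU : Undetectableₛ σ S Nc F) (s : ℕ) (hs : ∀ f ∈ F, f.cyc ≠ s) :
    Undetectableₛ σ S Nc (F.filter fun f => f.cyc < s) ∧ Undetectableₛ σ S Nc (F.filter fun f => s < f.cyc) := by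
  unfold Undetectableₛ at hU ⊢
  classical
  set A := F.filter fun f => f.cyc < s
  set B := F.filter fun f => s < f.cyc
  have hAB : Disjoint A B := by
    rw [Finset.disjoint_filter]; intro f _ h1 h2; omega
  have hF : F = A ∪ B := by
    ext f; simp only [A, B, Finset.mem_union, Finset.mem_filter]
    constructor
    · intro hf; rcases Nat.lt_or_gt_of_ne (hs f hf) with h | h
      · exact Or.inl ⟨hf, h⟩
      · exact Or.inr ⟨hf, h⟩
    · rintro (⟨hf, -⟩ | ⟨hf, -⟩) <;> exact hf
  -- detectors of each half vanish on the other half's layers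
  have hBlow : ∀ t, t ≤ s → (∀ i, Gen.detX S Nc (allEventsₛ σ Nc) B t i = false) ∧ (∀ j, Gen.detZ S Nc (allEventsₛ σ Nc) B t j = false) := by
    intro t ht
    refine ⟨fun i => ?_, fun j => ?_⟩
    · rw [Gen.detX_eq_bsum, bsum_congr (h := fun _ => false) (fun f hf => ?_)]; exact bsum_false _
      have hf' := Finset.mem_filter.1 hf
      exact detXₛ_local hσ Nc f (hN f hf'.1).1 (hN f hf'.1).2.1 ⟨by omega, by omega⟩ i
    · rw [Gen.detZ_eq_bsum, bsum_congr (h := fun _ => false) (fun f hf => ?_)]; exact bsum_false _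
      have hf' := Finset.mem_filter.1 hf
      exact detZₛ_local hσ Nc f (hN f hf'.1).2.2 (hN f hf'.1).1 (hN f hf'.1).2.1 ⟨by omega, by omega⟩ j
  have hAhigh : ∀ t, s < t → (∀ i, Gen.detX S Nc (allEventsₛ σ Nc) A t i = false) ∧ (∀ j, Gen.detZ S Nc (allEventsₛ σ Nc) A t j = false) := by
    intro t ht
    refine ⟨fun i => ?_, fun j => ?_⟩
    · rw [Gen.detX_eq_bsum, bsum_congr (h := fun _ => false) (fun f hf => ?_)]; exact bsum_false _
      have hf' := Finset.mem_filter.1 hf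
      exact detXₛ_local hσ Nc f (hN f hf'.1).1 (hN f hf'.1).2.1 ⟨by omega, by omega⟩ i
    · rw [Gen.detZ_eq_bsum, bsum_congr (h := fun _ => false) (fun f hf => ?_)]; exact bsum_false _
      have hf' := Finset.mem_filter.1 hf
      exact detZₛ_local hσ Nc f (hN f hf'.1).2.2 (hN f hf'.1).1 (hN f hf'.1).2.1 ⟨by omega, by omega⟩ j
  have hsumX : ∀ t i, Gen.detX S Nc (allEventsₛ σ Nc) F t i = xor (Gen.detX S Nc (allEventsₛ σ Nc) A t i) (Gen.detX S Nc (allEventsₛ σ Nc) B t i) := by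
    intro t i; rw [hF, Gen.detX_eq_bsum, Gen.detX_eq_bsum S Nc (allEventsₛ σ Nc) A, Gen.detX_eq_bsum S Nc (allEventsₛ σ Nc) B]; unfold bsum
    rw [Finset.filter_union, Finset.card_union_of_disjoint (Finset.disjoint_filter_filter hAB)]
    rcases Nat.mod_two_eq_zero_or_one (A.filter fun f => Gen.detX S Nc (allEventsₛ σ Nc) {f} t i = true).card with ha | ha <;>
    rcases Nat.mod_two_eq_zero_or_one (B.filter fun f => Gen.detX S Nc (allEventsₛ σ Nc) {f} t i = true).card with hb | hb <;>
    simp [Nat.add_mod, ha, hb]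
  have hsumZ : ∀ t j, Gen.detZ S Nc (allEventsₛ σ Nc) F t j = xor (Gen.detZ S Nc (allEventsₛ σ Nc) A t j) (Gen.detZ S Nc (allEventsₛ σ Nc) B t j) := by
    intro t j; rw [hF, Gen.detZ_eq_bsum, Gen.detZ_eq_bsum S Nc (allEventsₛ σ Nc) A, Gen.detZ_eq_bsum S Nc (allEventsₛ σ Nc) B]; unfold bsum
    rw [Finset.filter_union, Finset.card_union_of_disjoint (Finset.disjoint_filter_filter hAB)]
    rcases Nat.mod_two_eq_zero_or_one (A.filter fun f => Gen.detZ S Nc (allEventsₛ σ Nc) {f} t j = true).card with ha | ha <;>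
    rcases Nat.mod_two_eq_zero_or_one (B.filter fun f => Gen.detZ S Nc (allEventsₛ σ Nc) {f} t j = true).card with hb | hb <;>
    simp [Nat.add_mod, ha, hb]
  have hevA : ∀ f ∈ A, f.ev ∈ allEventsₛ σ Nc := fun f hf => hU.1 f (Finset.mem_filter.1 hf).1
  have hevB : ∀ f ∈ B, f.ev ∈ allEventsₛ σ Nc := fun f hf => hU.1 f (Finset.mem_filter.1 hf).1
  refine ⟨⟨hevA, fun t i => ⟨?_, ?_⟩⟩, ⟨hevB, fun t i => ⟨?_, ?_⟩⟩⟩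
  · rcases Nat.lt_or_ge s t with ht | ht
    · exact (hAhigh t ht).1 i
    · have := (hU.2 t i).1; rw [hsumX, (hBlow t ht).1 i, Bool.xor_false] at this; exact this
  · rcases Nat.lt_or_ge s t with ht | ht
    · exact (hAhigh t ht).2 i
    · have := (hU.2 t i).2; rw [hsumZ, (hBlow t ht).2 i, Bool.xor_false] at this; exact this
  · rcases Nat.lt_or_ge s t with ht | ht
    · have := (hU.2 t i).1; rw [hsumX, (hAhigh t ht).1 i, Bool.false_xor] at this; exact this
    · exact (hBlow t ht).1 i
  · rcases Nat.lt_or_ge s t with ht | ht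
    · have := (hU.2 t i).2; rw [hsumZ, (hAhigh t ht).2 i, Bool.false_xor] at this; exact this
    · exact (hBlow t ht).2 i

end Summit.Ventures.QEC.CircuitDistance
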